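import Summits.QuantumFields.BalabanUV.Gaps.EndDrawdownLinearRoad

/-!
# Gaps / EndDrawdownLinearRoadStrict — AT END GRADE THE EVERY-SLOPE ROAD IS STRICTLY MORE PERMISSIVE THAN EVERY LINEAR ROAD FOR POSSIBILITY:
# the explicit one-loop sequence `b_j = −κ ∕ 2^{⌊log₁₆(j+1)⌋}` (the rate HALVES each time the position grows SIXTEENFOLD, ≈ −κ·(j+1)^{−1∕4}) has
# bounded drawdown below every negative line — so it is POSSIBLE over the every-slope class on every box
# (`EndDrawdownEverySlopeDecided.endPossibleES_iff_dwSeq_neg`) — yet for EVERY constant `C > 0` and EVERY box `]0,γ₀]` NO realization whose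
# remainder obeys the linear modulus `|β¹| ≤ C·g_k` has `EndpointExistence`: `¬ EndPossibleLin b C γ₀` — ONE sequence defeats all linear roads.
# Mechanism (a dyadic staircase, elementary): along any in-box run of an (AF-1)-realization, forward generation gives the ONE-SIDED step
# `1∕g_i² ≤ 1∕g_{i+1}² + b_i + C g_i`; on the position block `t` (rate `ε_t = κ∕2^t`, `15·16^t` steps) the help `C g_i` is `≤ ε_t∕2` as long as
# `1∕g_i² ≥ T_t := (2^{t+1}C∕κ)²`, so `1∕g²` either descends by `ε_t∕2` per step or has dipped below `T_t`, and once below it stays; entering block `t`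
# below `4T_t = T_{t+1}` it leaves below `T_t` as soon as the block budget `15·16^t·ε_t∕2 = (15∕2)κ·8^t` exceeds `3T_t = 12·4^t C²∕κ²`, i.e. for all
# blocks `t ≥ t₀(C, κ)` (`8C² ≤ 5κ³2^t`) — the budget outgrows the threshold, which is why NO constant `C` survives; choosing the run length at a
# block boundary above the target, `1∕g² < T_{t₀}` at the left end of block `t₀` — outside the box `]0, 1∕√T_{t₀}]`.  With
# `EndDrawdownLinearRoad.endpointExistence_linCoop` (a quadratic drawdown profile ⟹ possible on the linear road) and `endForcedLin_iff_endForcedES`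
# (for forcing the roads coincide) this completes the comparison of row (D4)'s two located currencies at END grade
# (this seat's own leaf; cell pub-balaban-gaps, seat g1-p3 GEN 9, rows CAP ∕ tail ∕ (D4) «split ∕ weakening»; file 14 of «the one-loop interface
# of the END statement»)

HONEST FRAMING (cell rule, page 1 of everything): [folklore] window arithmetic along in-interval runs of forward-generated constructions for an
explicit TOY one-loop sequence; `EndPossibleLin` ∕ `EndPossibleES` are quantified READINGS of the cell's END-grade statement over Bałaban-free data,
not binders; both the every-slope currency and the linear (AF-1) currency of row (D4) are located UNPRINTED hypotheses (`CapSignsConstRoad` §1);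
nothing of Bałaban's table is certified (NODE-O 0∕1); words ∕ odds of rows CAP ∕ tail ∕ (D4) ∕ (D1) UNCHANGED.  Nothing of Bałaban's is asserted;
0∕6 binders; one finite T⁴; NOT [I] Thm 2, NOT `BetaPertH`, NOT the continuum limit, NOT Clay.

CITATION HEADER (tags CONTEXT ONLY).  [I] = T. Bałaban, Commun. Math. Phys. **109** (1987) 249–301 [Balaban1987RG1]: (0.20) p. 256, Thm 2
p. 259 (first sentence), Thm 3 p. 264, (2.12)–(2.14) p. 268.
-/

namespace Summit.QuantumFields.BalabanUV.Gaps.EndDrawdownLinearRoadStrict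

open Literature.MathematicalPhysics.QuantumFieldTheory.Balaban1983to89
open Literature.MathematicalPhysics.QuantumFieldTheory.Balaban1983to89.FlowStep
open Literature.MathematicalPhysics.QuantumFieldTheory.Balaban1983to89.FlowStepRuns
open Literature.MathematicalPhysics.QuantumFieldTheory.Balaban1983to89.DagBinding
open Summit.QuantumFields.BalabanUV.Gaps.CapSignsNecessaryFwd (step_ge_of_forwardGenerated)
open Summit.QuantumFields.BalabanUV.Gaps.EndDrawdownSeq
open Summit.QuantumFields.BalabanUV.Gaps.EndDrawdownEverySlope
open Summit.QuantumFields.BalabanUV.Gaps.EndDrawdownEverySlopeDecided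
open Summit.QuantumFields.BalabanUV.Gaps.EndDrawdownLinearRoad
open Finset

noncomputable section

/-! ## §1 The dyadic staircase `b_j = −κ ∕ 2^{⌊log₈(j+1)⌋}` and its drawdown -/

/-- The position block of index `j`: `blk j := ⌊log₁₆ (j+1)⌋`, so that block `t` is `{j : 16^t ≤ j+1 < 16^{t+1}}` (`15·16^t` indices). [folklore] -/
def blk (j : ℕ) : ℕ := Nat.log 16 (j + 1)

/-- THE DYADIC STAIRCASE · `b_j := −κ ∕ 2^{blk j}` — rate `κ` on block `0`, halved on each successive block (≈ `−κ (j+1)^{−1∕4}`). A TOY. [folklore] -/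
def bStair (κ : ℝ) (j : ℕ) : ℝ := -(κ / 2 ^ blk j)

/-- Block membership: `blk j = t ⟺ 16^t ≤ j + 1 < 16^{t+1}`. [folklore] -/
theorem blk_eq_iff {j t : ℕ} : blk j = t ↔ 16 ^ t ≤ j + 1 ∧ j + 1 < 16 ^ (t + 1) :=
  Nat.log_eq_iff (Or.inr ⟨by norm_num, Nat.succ_ne_zero j⟩)

/-- Indices of block `t`: `16^t ≤ j + 1 < 16^{t+1} ⟹ blk j = t`. [folklore] -/
theorem blk_of_mem {j t : ℕ} (h1 : 16 ^ t ≤ j + 1) (h2 : j + 1 < 16 ^ (t + 1)) : blk j = t := blk_eq_iff.mpr ⟨h1, h2⟩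

/-- Below block `t` the index is small: `blk j < t ⟹ j + 1 < 16^t`. [folklore] -/
theorem lt_pow_of_blk_lt {j t : ℕ} (h : blk j < t) : j + 1 < 16 ^ t :=
  lt_of_lt_of_le (Nat.lt_pow_succ_log_self (by norm_num) (j + 1)) (Nat.pow_le_pow_right (by norm_num) h)

/-- **THE STAIRCASE HAS BOUNDED DRAWDOWN BELOW EVERY NEGATIVE LINE** (`0 ≤ κ`): at threshold `ε > 0` pick `t` with `κ∕2^t ≤ ε`; the terms of
blocks `≥ t` lie above the line, the `< 16^t` earlier terms are each `≥ −κ`, so every window sum of `b + ε` is `≥ −κ·16^t`. [folklore] -/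
theorem dwSeq_neg_bStair {κ : ℝ} (hκ : 0 ≤ κ) {ε : ℝ} (hε : 0 < ε) : DwSeq (bStair κ) (-ε) := by
  obtain ⟨t, ht⟩ := exists_pow_lt_of_lt_one (show 0 < ε / (κ + 1) by positivity) (show ((2 : ℝ)⁻¹) < 1 by norm_num)
  have hεt : κ / 2 ^ t ≤ ε := by
    have h1 : κ / 2 ^ t = κ * ((2 : ℝ)⁻¹) ^ t := by rw [inv_pow, div_eq_mul_inv]
    rw [h1]
    have h2 : κ * ((2 : ℝ)⁻¹) ^ t ≤ (κ + 1) * (ε / (κ + 1)) :=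
      mul_le_mul (by linarith) ht.le (pow_nonneg (by norm_num) t) (by linarith)
    rwa [mul_div_cancel₀ _ (by positivity : (κ + 1 : ℝ) ≠ 0)] at h2
  refine ⟨κ * 16 ^ t, fun k n hkn => ?_⟩
  have hterm : ∀ j : ℕ, -(if j + 1 < 16 ^ t then κ else 0) ≤ bStair κ j - -ε := by
    intro j
    unfold bStair
    split_ifs with hj
    · have : κ / 2 ^ blk j ≤ κ := div_le_self hκ (one_le_pow₀ (by norm_num))
      linarith
    · have hbt : t ≤ blk j := not_lt.mp fun h => hj (lt_pow_of_blk_lt h)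
      have : κ / 2 ^ blk j ≤ κ / 2 ^ t := div_le_div_of_nonneg_left hκ (by positivity) (pow_le_pow_right₀ (by norm_num) hbt)
      linarith
  have hsum : -(∑ j ∈ Finset.Ico k n, (if j + 1 < 16 ^ t then κ else 0)) ≤ ∑ j ∈ Finset.Ico k n, (bStair κ j - -ε) := by
    rw [← Finset.sum_neg_distrib]; exact Finset.sum_le_sum fun j _ => hterm j
  have hcount : ∑ j ∈ Finset.Ico k n, (if j + 1 < 16 ^ t then κ else 0) ≤ κ * 16 ^ t := by
    rw [Finset.sum_ite, Finset.sum_const_zero, add_zero, Finset.sum_const, nsmul_eq_mul]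
    have hc : (((Finset.Ico k n).filter (fun j => j + 1 < 16 ^ t)).card : ℝ) ≤ 16 ^ t := by
      have h1 : ((Finset.Ico k n).filter (fun j => j + 1 < 16 ^ t)).card ≤ (Finset.range (16 ^ t)).card :=
        Finset.card_le_card fun j hj => by
          simp only [Finset.mem_filter, Finset.mem_Ico, Finset.mem_range] at hj ⊢
          omega
      rw [Finset.card_range] at h1
      exact_mod_cast h1
    nlinarith
  linarith

/-- … hence the staircase is POSSIBLE over the every-slope class on every box (`0 ≤ κ`, `0 < γc`). [cite: Balaban1987RG1, Thm 2 p.259 (first sentence) and Thm 3 p.264] -/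
theorem endPossibleES_bStair {κ : ℝ} (hκ : 0 ≤ κ) {γc : ℝ} (hγc : 0 < γc) : EndPossibleES (bStair κ) γc :=
  (endPossibleES_iff_dwSeq_neg hγc).mpr fun _ hε => dwSeq_neg_bStair hκ hε

/-! ## §2 The descent along any (AF-1)-realization: block by block below the thresholds `T_t = (2^{t+1} C ∕ κ)²` -/

section Descent

variable {κ C : ℝ}

/-- The coupling threshold of block `t`: `s_t := κ ∕ (2C·2^t)` (help `C·g ≤ ε_t∕2 = κ∕2^{t+1}` iff `g ≤ s_t`). [folklore] -/
def sThr (κ C : ℝ) (t : ℕ) : ℝ := κ / (2 * C * 2 ^ t)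

/-- The `1∕g²`-threshold of block `t`: `T_t := 1 ∕ s_t²`. [folklore] -/
def TThr (κ C : ℝ) (t : ℕ) : ℝ := 1 / sThr κ C t ^ 2

/-- `T_{t+1} = 4 T_t`. [folklore] -/
theorem TThr_succ (hκ : 0 < κ) (hC : 0 < C) (t : ℕ) : TThr κ C (t + 1) = 4 * TThr κ C t := by
  unfold TThr sThr
  have h2 : (2 : ℝ) ^ (t + 1) = 2 * 2 ^ t := by rw [pow_succ]; ring
  rw [h2]
  field_simp
  ring

/-- The block budget of block `t`: `15·16^t · (κ∕2^{t+1}) ≥ 3 T_t` as soon as `8 C² ≤ 5 κ³ 2^t` — the budget `(15∕2)κ·8^t` outgrows the threshold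
`3T_t = 12·4^t C²∕κ²`, so EVERY constant `C` is eventually beaten. [folklore] -/
theorem block_budget (hκ : 0 < κ) (hC : 0 < C) (t : ℕ) (ht : 8 * C ^ 2 ≤ 5 * κ ^ 3 * 2 ^ t) :
    3 * TThr κ C t ≤ 15 * 16 ^ t * (κ / 2 ^ (t + 1)) := by
  unfold TThr sThr
  set X : ℝ := 2 ^ t with hX
  have hXpos : 0 < X := by positivity
  have hX0 : X ≠ 0 := hXpos.ne'
  have hκ0 : κ ≠ 0 := hκ.ne'
  have hC0 : C ≠ 0 := hC.ne'
  have h16 : (16 : ℝ) ^ t = X ^ 4 := by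
    rw [hX, ← pow_mul, show (16 : ℝ) = 2 ^ 4 by norm_num, ← pow_mul, mul_comm]
  have h2 : (2 : ℝ) ^ (t + 1) = 2 * X := by rw [pow_succ]; ring
  rw [h16, h2]
  have key : 15 * X ^ 4 * (κ / (2 * X)) - 3 * (1 / (κ / (2 * C * X)) ^ 2) = 3 * X ^ 2 * (5 * κ ^ 3 * X - 8 * C ^ 2) / (2 * κ ^ 2) := by
    field_simp
    ring
  have hnn : 0 ≤ 3 * X ^ 2 * (5 * κ ^ 3 * X - 8 * C ^ 2) / (2 * κ ^ 2) :=
    div_nonneg (mul_nonneg (by positivity) (sub_nonneg.mpr ht)) (by positivity)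
  linarith

/-- HELP BOUND · in the box, `T_t ≤ 1∕g²` ⟹ `C·g ≤ κ∕2^{t+1}`. [folklore] -/
theorem help_le_of_TThr_le (hκ : 0 < κ) (hC : 0 < C) (t : ℕ) {g : ℝ} (hg : 0 < g) (hT : TThr κ C t ≤ 1 / g ^ 2) :
    C * g ≤ κ / 2 ^ (t + 1) := by
  have hs : 0 < sThr κ C t := by unfold sThr; positivity
  have h1 : g ^ 2 ≤ sThr κ C t ^ 2 := by
    unfold TThr at hT
    exact (one_div_le_one_div (pow_pos hs 2) (pow_pos hg 2)).mp hT
  have h2 : g ≤ sThr κ C t := (pow_le_pow_iff_left₀ hg.le hs.le two_ne_zero).mp h1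
  calc C * g ≤ C * sThr κ C t := mul_le_mul_of_nonneg_left h2 hC.le
    _ = κ / 2 ^ (t + 1) := by unfold sThr; rw [pow_succ]; field_simp

/-- TELESCOPING a uniform descent: `y_i ≤ y_{i+1} − δ` on `[lo, hi)` ⟹ `y_lo ≤ y_hi − (hi − lo)·δ`. [folklore] -/
theorem chain_descent {y : ℕ → ℝ} {δ : ℝ} {lo hi : ℕ} (hlh : lo ≤ hi) (h : ∀ i, lo ≤ i → i < hi → y i ≤ y (i + 1) - δ) :
    y lo ≤ y hi - ((hi : ℝ) - lo) * δ := by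
  induction hi, hlh using Nat.le_induction with
  | base => simp
  | succ hi hlh ih =>
    have h1 := ih fun i hi1 hi2 => h i hi1 (Nat.lt_succ_of_lt hi2)
    have h2 := h hi hlh (Nat.lt_succ_self hi)
    push_cast
    linarith

/-- **ONE BLOCK OF THE DESCENT** · a real sequence `y` on the indices of block `t` with the one-sided staircase step
`y_i ≤ y_{i+1} − κ∕2^t + h_i` (`i ∈ [16^t − 1, 16^{t+1} − 1)`), help `h_i ≤ κ∕2^{t+1}` whenever `T_t ≤ y_i`, and the budget condition
`8C² ≤ 5κ³2^t`: entering below `4T_t` (`y_{16^{t+1}−1} < 4 T_t`) it leaves below `T_t` (`y_{16^t − 1} < T_t`) — either it descends by `κ∕2^{t+1}` at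
every step (budget `≥ 3T_t`) or it dips below `T_t`, and below `T_t` it stays. [folklore] -/
theorem block_descent (hκ : 0 < κ) (hC : 0 < C) (t : ℕ) (ht : 8 * C ^ 2 ≤ 5 * κ ^ 3 * 2 ^ t) {y h : ℕ → ℝ}
    (hstep : ∀ i, 16 ^ t - 1 ≤ i → i < 16 ^ (t + 1) - 1 → y i ≤ y (i + 1) - κ / 2 ^ t + h i)
    (hhelp : ∀ i, 16 ^ t - 1 ≤ i → i < 16 ^ (t + 1) - 1 → TThr κ C t ≤ y i → h i ≤ κ / 2 ^ (t + 1))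
    (henter : y (16 ^ (t + 1) - 1) < 4 * TThr κ C t) : y (16 ^ t - 1) < TThr κ C t := by
  set lo := 16 ^ t - 1 with hlo
  set hi := 16 ^ (t + 1) - 1 with hhi
  have h16t : 1 ≤ 16 ^ t := Nat.one_le_pow _ _ (by norm_num)
  have h16t1 : 16 ^ (t + 1) = 16 * 16 ^ t := by rw [pow_succ]; ring
  have hlohi : lo ≤ hi := by omega
  have hlen : ((hi : ℝ) - lo) = 15 * 16 ^ t := by
    have : hi = lo + 15 * 16 ^ t := by omega
    rw [this]; push_cast; ring
  have hε : κ / 2 ^ t - κ / 2 ^ (t + 1) = κ / 2 ^ (t + 1) := by rw [pow_succ]; field_simp; ring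
  -- below `T_t` one stays below (leftward)
  have hstay : ∀ d i, i + d ≤ hi → lo ≤ i → y (i + d) < TThr κ C t → y i < TThr κ C t := by
    intro d
    induction d with
    | zero => intro i _ _ hy; simpa using hy
    | succ d ih =>
      intro i hid hloi hy
      have h1 : y (i + 1) < TThr κ C t := ih (i + 1) (by omega) (by omega) (by rw [show i + 1 + d = i + (d + 1) by omega]; exact hy)
      by_contra hge
      have hge' : TThr κ C t ≤ y i := not_lt.mp hge
      have hs := hstep i hloi (by omega)
      have hh := hhelp i hloi (by omega) hge'
      have hεpos : 0 < κ / 2 ^ (t + 1) := by positivity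
      linarith
  -- some index of the block (or its right end) lies below `T_t`
  have hdip : ∃ i, lo ≤ i ∧ i ≤ hi ∧ y i < TThr κ C t := by
    by_contra hno
    simp only [not_exists, not_and, not_lt] at hno
    have hdesc : ∀ i, lo ≤ i → i < hi → y i ≤ y (i + 1) - κ / 2 ^ (t + 1) := by
      intro i h1 h2
      have hs := hstep i h1 h2
      have hh := hhelp i h1 h2 (hno i h1 h2.le)
      linarith
    have hch := chain_descent hlohi hdesc
    rw [hlen] at hch
    have hb := block_budget hκ hC t ht
    have hlo_ge := hno lo le_rfl hlohi
    linarith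
  obtain ⟨i, hloi, hihi, hyi⟩ := hdip
  obtain ⟨d, rfl⟩ := Nat.exists_eq_add_of_le hloi
  exact hstay d lo (by omega) le_rfl hyi

end Descent

/-! ## §3 No (AF-1)-realization of the staircase has the END -/

/-- `T_t = 4^t · T_0`. [folklore] -/
theorem TThr_eq_pow {κ C : ℝ} (hκ : 0 < κ) (hC : 0 < C) : ∀ t : ℕ, TThr κ C t = 4 ^ t * TThr κ C 0
  | 0 => by simp
  | t + 1 => by rw [TThr_succ hκ hC, TThr_eq_pow hκ hC t, pow_succ]; ring

/-- `T_0 = 4C²∕κ² > 0` and the thresholds are unbounded. [folklore] -/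
theorem TThr_zero_pos {κ C : ℝ} (hκ : 0 < κ) (hC : 0 < C) : 0 < TThr κ C 0 := by unfold TThr sThr; positivity

/-- **THE STAIRCASE IS IMPOSSIBLE ON EVERY LINEAR ROAD** · `0 < κ`, `0 < C`, `0 < γ₀` (NO relation between `C` and `κ`): NO realization of
`b = bStair κ` whose remainder obeys `|β¹_{k+1}| ≤ C·g_k` on the `]0,γ₀]`-histories, with (C), under ANY forward-generated construction, has
`EndpointExistence`.  Proof: a first good block `t₀` (`8C² ≤ 5κ³2^{t₀}`), the box `γ ≤ min(γ₂, γ₀, 1∕√T_{t₀})`, the target `g⋆` itself, a block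
boundary `K = 16^{t_K+1} − 1` with `t_K ≥ t₀` and `1∕g⋆² < 4T_{t_K}`; the forward-generated one-sided steps `1∕g_i² ≤ 1∕g_{i+1}² + b_i + C g_i` feed
`block_descent` from block `t_K` down to block `t₀`, ending at `1∕g² < T_{t₀} ≤ 1∕γ²` at the left end of block `t₀` — outside the box.
(For `γ₀ ≤ 0` the linear hypothesis is empty and the statement fails.) [cite: Balaban1987RG1, (0.20) p.256 and Thm 2 p.259 (first sentence)] -/
theorem not_endPossibleLin_bStair {κ C γ₀ : ℝ} (hκ : 0 < κ) (hC : 0 < C) (hγ₀ : 0 < γ₀) :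
    ¬ EndPossibleLin (bStair κ) C γ₀ := by
  rintro ⟨β, Sβ, Cn, hb, hAF, -, hgen, hE⟩
  -- the first good block
  obtain ⟨t₀, ht₀⟩ : ∃ t₀ : ℕ, 8 * C ^ 2 ≤ 5 * κ ^ 3 * 2 ^ t₀ := by
    obtain ⟨n, hn⟩ := pow_unbounded_of_one_lt (8 * C ^ 2 / (5 * κ ^ 3)) (by norm_num : (1 : ℝ) < 2)
    exact ⟨n, by rw [div_lt_iff₀ (by positivity)] at hn; linarith⟩
  have hgood : ∀ t, t₀ ≤ t → 8 * C ^ 2 ≤ 5 * κ ^ 3 * 2 ^ t := fun t ht =>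
    ht₀.trans (mul_le_mul_of_nonneg_left (pow_le_pow_right₀ (by norm_num) ht) (by positivity))
  have hs₀ : 0 < sThr κ C t₀ := by unfold sThr; positivity
  obtain ⟨γ₂, hγ₂, hγ⟩ := hE 0
  set γ : ℝ := min γ₂ (min γ₀ (sThr κ C t₀)) with hγdef
  have hγpos : 0 < γ := lt_min hγ₂ (lt_min hγ₀ hs₀)
  have hγle₀ : γ ≤ γ₀ := (min_le_right _ _).trans (min_le_left _ _)
  have hγles : γ ≤ sThr κ C t₀ := (min_le_right _ _).trans (min_le_right _ _)
  obtain ⟨gstar, hgstar, hg⟩ := hγ γ hγpos (min_le_left _ _)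
  -- a block boundary `t_K ≥ t₀` above the target height `Y = 1∕g⋆²`
  have hT0 := TThr_zero_pos hκ hC
  obtain ⟨tK, htK₀, htK⟩ : ∃ tK : ℕ, t₀ ≤ tK ∧ 1 / gstar ^ 2 < 4 * TThr κ C tK := by
    obtain ⟨n, hn⟩ := pow_unbounded_of_one_lt (1 / gstar ^ 2 / TThr κ C 0) (by norm_num : (1 : ℝ) < 4)
    refine ⟨max n t₀, le_max_right _ _, ?_⟩
    rw [TThr_eq_pow hκ hC (max n t₀)]
    have h1 := (div_lt_iff₀ hT0).mp hn
    have h2 : (4 : ℝ) ^ n ≤ 4 ^ max n t₀ := pow_le_pow_right₀ (by norm_num) (le_max_left _ _)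
    nlinarith [pow_pos (by norm_num : (0 : ℝ) < 4) n]
  set K : ℕ := 16 ^ (tK + 1) - 1 with hK
  obtain ⟨g0, hI, hend⟩ := hg gstar hgstar le_rfl K
  set P : B12.RunParams := ⟨K, 0, g0⟩ with hP
  have hposj : ∀ j, j ≤ K → 0 < (Cn P).flow.g j := fun j hj => (hI j hj).1
  have hlej : ∀ j, j ≤ K → (Cn P).flow.g j ≤ γ := fun j hj => (hI j hj).2
  have hendK : 1 / ((Cn P).flow.g K) ^ 2 = 1 / gstar ^ 2 := by
    have h : (Cn P).flow.g K = gstar := hend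
    rw [h]
  -- the one-sided staircase steps along the run, with the linear help
  have hstep : ∀ i, i < K → 1 / ((Cn P).flow.g i) ^ 2 ≤ 1 / ((Cn P).flow.g (i + 1)) ^ 2 - κ / 2 ^ blk i + C * (Cn P).flow.g i := by
    intro i hi
    have h1 := step_ge_of_forwardGenerated hgen P hI hi
    have hpre : prefixOf (Cn P).flow.g i ∈ B12Beta.HistBox γ₀ i := fun l =>
      ⟨hposj l (by have := Fin.is_le l; omega), (hlej l (by have := Fin.is_le l; omega)).trans hγle₀⟩
    have h2 := (abs_le.mp (hAF i (prefixOf (Cn P).flow.g i) hpre)).2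
    simp only [prefixOf_apply, Fin.val_last] at h2
    have h4 : β i (prefixOf (Cn P).flow.g i) = bStair κ i + Sβ.β1 i (prefixOf (Cn P).flow.g i) := by rw [Sβ.split i, hb i]
    rw [h4, bStair] at h1
    linarith
  have hstep_blk : ∀ t i, 16 ^ t - 1 ≤ i → i < 16 ^ (t + 1) - 1 → i < K →
      1 / ((Cn P).flow.g i) ^ 2 ≤ 1 / ((Cn P).flow.g (i + 1)) ^ 2 - κ / 2 ^ t + C * (Cn P).flow.g i := by
    intro t i h1 h2 hiK
    have h16 : 1 ≤ 16 ^ t := Nat.one_le_pow _ _ (by norm_num)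
    have hb' : blk i = t := blk_of_mem (by omega) (by omega)
    have h := hstep i hiK
    rwa [hb'] at h
  have hhelp : ∀ t i, i ≤ K → TThr κ C t ≤ 1 / ((Cn P).flow.g i) ^ 2 → C * (Cn P).flow.g i ≤ κ / 2 ^ (t + 1) :=
    fun t i hi hT => help_le_of_TThr_le hκ hC t (hposj i hi) hT
  -- block by block, from `t_K` down to `t₀`
  have hBC : ∀ d, d ≤ tK - t₀ → 1 / ((Cn P).flow.g (16 ^ (tK - d) - 1)) ^ 2 < TThr κ C (tK - d) := by
    intro d
    induction d with
    | zero =>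
      intro _
      rw [Nat.sub_zero]
      refine block_descent hκ hC tK (hgood tK htK₀) (y := fun i => 1 / ((Cn P).flow.g i) ^ 2) (h := fun i => C * (Cn P).flow.g i)
        (fun i h1 h2 => hstep_blk tK i h1 h2 (by omega)) (fun i _ h2 hT => hhelp tK i (by omega) hT) ?_
      show 1 / ((Cn P).flow.g (16 ^ (tK + 1) - 1)) ^ 2 < 4 * TThr κ C tK
      rw [← hK, hendK]
      exact htK
    | succ d ih =>
      intro hd
      have ih' := ih (by omega)
      have ht1 : tK - d = tK - (d + 1) + 1 := by omega
      have hpow : 16 ^ (tK - (d + 1) + 1) ≤ 16 ^ (tK + 1) := Nat.pow_le_pow_right (by norm_num) (by omega)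
      refine block_descent hκ hC (tK - (d + 1)) (hgood _ (by omega)) (y := fun i => 1 / ((Cn P).flow.g i) ^ 2)
        (h := fun i => C * (Cn P).flow.g i)
        (fun i h1 h2 => hstep_blk _ i h1 h2 (by omega)) (fun i _ h2 hT => hhelp _ i (by omega) hT) ?_
      show 1 / ((Cn P).flow.g (16 ^ (tK - (d + 1) + 1) - 1)) ^ 2 < 4 * TThr κ C (tK - (d + 1))
      rw [← TThr_succ hκ hC, ← ht1]
      exact ih'
  have h0 := hBC (tK - t₀) le_rfl
  rw [show tK - (tK - t₀) = t₀ by omega] at h0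
  -- but the box `γ ≤ 1∕√T_{t₀}` puts `1∕g²` above `T_{t₀}` at every index of the run
  have h16 : 1 ≤ 16 ^ t₀ := Nat.one_le_pow _ _ (by norm_num)
  have hidx : 16 ^ t₀ - 1 ≤ K := by
    have : 16 ^ t₀ ≤ 16 ^ (tK + 1) := Nat.pow_le_pow_right (by norm_num) (by omega)
    omega
  have hgi := hposj (16 ^ t₀ - 1) hidx
  have hgile : (Cn P).flow.g (16 ^ t₀ - 1) ≤ sThr κ C t₀ := (hlej _ hidx).trans hγles
  have h1 : TThr κ C t₀ ≤ 1 / ((Cn P).flow.g (16 ^ t₀ - 1)) ^ 2 := by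
    unfold TThr
    exact one_div_le_one_div_of_le (pow_pos hgi 2) (pow_le_pow_left₀ hgi.le hgile 2)
  linarith

/-! ## §4 The separation -/

/-- **THE EVERY-SLOPE ROAD IS STRICTLY MORE PERMISSIVE THAN EVERY LINEAR ROAD FOR POSSIBILITY** · ONE one-loop sequence (the dyadic staircase
with `κ = 1`) is POSSIBLE over the every-slope class on every box and IMPOSSIBLE over the linear class `|β¹| ≤ C·g_k` for EVERY constant `C > 0` and
every box — whereas for FORCING the roads coincide (`EndDrawdownLinearRoad.endForcedLin_iff_endForcedES`).
[cite: Balaban1987RG1, Thm 3 p.264 and (2.12)–(2.14) p.268] -/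
theorem everySlope_possible_not_linear :
    ∃ b : ℕ → ℝ, (∀ γc : ℝ, 0 < γc → EndPossibleES b γc) ∧ ∀ C γ₀ : ℝ, 0 < C → 0 < γ₀ → ¬ EndPossibleLin b C γ₀ :=
  ⟨bStair 1, fun _ hγc => endPossibleES_bStair zero_le_one hγc, fun _ _ hC hγ₀ => not_endPossibleLin_bStair one_pos hC hγ₀⟩

/-- THE THIRD LINK ON THE LINEAR ROAD, SHARPENED · `∀ ε > 0, DwSeq b (−ε)` is NECESSARY for possibility on a linear road
(`EndDrawdownLinearRoad.dwSeq_neg_of_endPossibleLin`) but NOT SUFFICIENT on any of them (the staircase), while a quadratic drawdown profile IS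
sufficient (`EndDrawdownLinearRoad.endPossibleLin_of_quadraticProfile`): possibility on the linear road reads the SIZE of the drawdown profile of
`β⁰` against `ε⁻²`, not only its finiteness. [folklore] -/
theorem dwSeq_neg_not_sufficient_linear :
    ∃ b : ℕ → ℝ, (∀ ε : ℝ, 0 < ε → DwSeq b (-ε)) ∧ ∀ C γ₀ : ℝ, 0 < C → 0 < γ₀ → ¬ EndPossibleLin b C γ₀ :=
  ⟨bStair 1, fun _ hε => dwSeq_neg_bStair zero_le_one hε, fun _ _ hC hγ₀ => not_endPossibleLin_bStair one_pos hC hγ₀⟩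

/-- IN THE UNION OF ALL LINEAR ROADS POSSIBILITY IS STILL STRICTLY STRONGER than on the every-slope road: `∃ C > 0, EndPossibleLin b C γ₀` implies
`EndPossibleES b γ₀` (`endPossibleES_of_endPossibleLin`) and the staircase separates. [folklore] -/
theorem exists_linear_possible_strict {γ₀ : ℝ} (hγ₀ : 0 < γ₀) :
    (∀ b : ℕ → ℝ, (∃ C : ℝ, 0 < C ∧ EndPossibleLin b C γ₀) → EndPossibleES b γ₀) ∧
      ∃ b : ℕ → ℝ, EndPossibleES b γ₀ ∧ ¬ ∃ C : ℝ, 0 < C ∧ EndPossibleLin b C γ₀ :=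
  ⟨fun _ ⟨_, hC, h⟩ => endPossibleES_of_endPossibleLin hC.le hγ₀ h,
    ⟨bStair 1, endPossibleES_bStair zero_le_one hγ₀, fun ⟨_, hC, h⟩ => not_endPossibleLin_bStair one_pos hC hγ₀ h⟩⟩

end

end Summit.QuantumFields.BalabanUV.Gaps.EndDrawdownLinearRoadStrict
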